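import Literature.AlgebraicGeometry.Motives.UniversalHyperplaneSection
import Literature.AlgebraicGeometry.Motives.ProjBasicOpenSubscheme
import Literature.AlgebraicGeometry.Motives.AlgPointsProperProofs
import Literature.AlgebraicGeometry.Motives.ReducedClosedSubschemeIso
import Mathlib.AlgebraicGeometry.Morphisms.ClosedImmersion
import HarnessLib

/-!
# Affine charts of the universal hyperplane section `𝒳 ⊆ X ×ₖ (ℙᴺ)^*`

Topic `Literature/AlgebraicGeometry/Motives`; companion (definitions + theorems, no named facts) of
`Motives/UniversalHyperplaneSection`, which constructs for `ι : X ⟶ ℙᴺ_k` the universal hyperplane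
section `𝒳 = {(x, a) | Σᵢ aᵢ xᵢ(x) = 0}` as the REDUCED closed subscheme of `X ×ₖ (ℙᴺ)^*` supported on
the incidence locus (the preimage of the universal hyperplane `V₊(Σᵢ z_{ii})` under `ι ×ₖ 𝟙` and the
Segre embedding). This file provides its local equations, the input of every smoothness statement
about `π = pr₂ : 𝒳 ⟶ (ℙᴺ)^*` (Voisin II §3.2.2: "`φ = pr₂` is a submersion with smooth fibre `X_H`
over `H`"; Voisin II §2.1.1 for the analogous `ℙ`-bundle `Z → X`). For an affine open
`X' ⊆ ι⁻¹D₊(x_j)` of `X` and a chart `D₊(a_l)` of `(ℙᴺ)^*`, with `R = (k[a]_{(a_l)})₀`: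

* `chartRing l X' = Γ(X, X') ⊗ₖ R` (file-local `k`-algebra instances `chartBaseRingAlgebra`,
  `sectionsAlgebra`) and the open immersion
  `chartImm X l X' : Spec (Γ(X, X') ⊗ₖ R) = X' ×ₖ D₊(a_l) ↪ X ×ₖ (ℙᴺ)^*` (Mathlib `pullbackSpecIso`
  and the fibre product of `X' ↪ X`, `D₊(a_l) ↪ (ℙᴺ)^*`), with its image (`range_chartImm`) and its
  two projections (`chartImm_fst`, `chartImm_snd`: `pr₂ ∘ chart = (Spec R = D₊(a_l) ↪ (ℙᴺ)^*) ∘ Spec`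
  of `R → Γ ⊗ R`, i.e. the chart is compatible with `π`);
* `secCoord ι j X' _ i = uᵢ = ι^*(xᵢ/x_j)|_{X'}` and `incidenceFun = g = Σᵢ uᵢ ⊗ (aᵢ/a_l)`, the
  incidence form `Σᵢ aᵢ xᵢ` divided by `x_j a_l`;
* `chartImm_toSegre` — the chart followed by `X ×ₖ (ℙᴺ)^* → ℙᴺ ×ₖ (ℙᴺ)^* → ℙ^{N²+2N}` is the
  chart-level Segre map (`Segre.segreMap`, `z_{cd}/z_{jl} ↦ (x_c/x_j)(a_d/a_l)`, from
  `Motives/SegreEmbedding`), whence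
* `preimage_chartImm_incidenceLocus` — **in the chart the incidence locus is `{g = 0}`**;
* `chartSection X ι l X' = 𝒳 ∩ (X' ×ₖ D₊(a_l))` (a fibre product) with its closed immersion
  `chartSectionι` into the chart (image `{g = 0}`, `range_chartSectionι`) and its open immersion
  `chartSectionToSection` into `𝒳`; `𝒳` and its pieces are reduced
  (`isReduced_universalHyperplaneSection_left`), so **any reduced closed subscheme of the chart
  supported on `{g = 0}` is isomorphic to `𝒳 ∩ (X' ×ₖ D₊(a_l))` over the chart**
  (`exists_iso_chartSection`, uniqueness of the reduced induced structure, Hartshorne II Example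
  3.2.6 via `Motives/ReducedClosedSubschemeIso`) — e.g. for `j ≠ l` the graph
  `Spec Γ(X, X')[aᵢ/a_l : i ≠ j, l]` of `a_j/a_l = -(u_l + Σ_{i ≠ j, l} uᵢ aᵢ/a_l)`, which is how the
  `ℙᴺ⁻¹`-bundle structure of `𝒳 → X` and the smoothness of `π` near a smooth fibre are read off.

## References

* [VoisinHodgeII2003] C. Voisin, Hodge Theory and Complex Algebraic Geometry II, CUP 2003, §2.1.1,
  §3.2.2.
* [Hartshorne1977] R. Hartshorne, Algebraic Geometry, II Prop. 2.5, II Example 3.2.6, II Ex. 5.11.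
-/

noncomputable section

open CategoryTheory AlgebraicGeometry Limits MonoidalCategory CartesianMonoidalCategory
  HomogeneousLocalization TensorProduct

universe u

namespace Literature.AlgebraicGeometry.Motives

attribute [local instance] MvPolynomial.gradedAlgebra

namespace UniversalHyperplaneSection

variable {k : Type u} [Field k] (N : ℕ) {X : SchemeOver k} (ι : X ⟶ projectiveSpace N k)

/-- Notation-free abbreviation: the grading of `k[x₀, …, x_N]`. -/
local notation "𝒜" => Segre.grading (Fin (N + 1)) k

/-! ### The rings of the chart -/

/-- The coordinate ring `(k[a]_{(a_l)})₀` of the standard chart `D₊(a_l) ⊆ (ℙᴺ)^*`. [folklore] -/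
abbrev chartBaseRing (l : Fin (N + 1)) : Type u := Away 𝒜 (MvPolynomial.X l)

/-- The chart `D₊(a_l) = Spec (k[a]_{(a_l)})₀ ↪ (ℙᴺ)^*` (Mathlib `Proj.awayι`). [folklore] -/
abbrev chartBaseι (l : Fin (N + 1)) : Spec (.of (chartBaseRing (k := k) N l)) ⟶ (dualProjectiveSpace N k).left :=
  Segre.chartι k l

/-- `D₊(a_l) ↪ (ℙᴺ)^* → Spec k` is `Spec` of the scalars `k → (k[a]_{(a_l)})₀`. [folklore] -/
theorem chartBaseι_hom (l : Fin (N + 1)) :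
    chartBaseι N l ≫ (dualProjectiveSpace N k).hom = Spec.map (CommRingCat.ofHom (Segre.cst k (MvPolynomial.X l))) :=
  Segre.chartι_toSpec k l

variable {N}

/-- For an affine open `X' ⊆ ι⁻¹D₊(x_j)` of `X`: the ring map `(k[x]_{(x_j)})₀ → Γ(X, X')`,
`x_i/x_j ↦ ι^*(x_i/x_j)|_{X'}` (Mathlib `Proj.awayToSection` and `Scheme.Hom.appLE`). [folklore] -/
def coordRingHom (j : Fin (N + 1)) (X' : X.left.Opens)
    (h : X' ≤ ι.left ⁻¹ᵁ Proj.basicOpen 𝒜 (MvPolynomial.X j)) :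
    Away 𝒜 (MvPolynomial.X j) →+* Γ(X.left, X') :=
  (ι.left.appLE (Proj.basicOpen 𝒜 (MvPolynomial.X j)) X' h).hom.comp (Proj.awayToSection 𝒜 (MvPolynomial.X j)).hom

/-- The regular functions `u_i = ι^*(x_i/x_j)|_{X'} ∈ Γ(X, X')`. [folklore] -/
def secCoord (j : Fin (N + 1)) (X' : X.left.Opens)
    (h : X' ≤ ι.left ⁻¹ᵁ Proj.basicOpen 𝒜 (MvPolynomial.X j)) (i : Fin (N + 1)) : Γ(X.left, X') :=
  coordRingHom ι j X' h (Segre.frac k j i)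

/-- `u_j = 1`. [folklore] -/
@[simp]
theorem secCoord_self (j : Fin (N + 1)) (X' : X.left.Opens)
    (h : X' ≤ ι.left ⁻¹ᵁ Proj.basicOpen 𝒜 (MvPolynomial.X j)) : secCoord ι j X' h j = 1 := by
  simp [secCoord]

/-- For an affine open `X'`, `Spec Γ(X, X') → X → Spec k` is `Spec` of the scalars. [folklore] -/
theorem fromSpec_comp_hom {X' : X.left.Opens} (hX' : IsAffineOpen X') :
    hX'.fromSpec ≫ X.hom = Spec.map (CommRingCat.ofHom (SchemeOver.scalarRingHom X X')) := by
  have h1 := IsAffineOpen.SpecMap_appLE_fromSpec X.hom (isAffineOpen_top _) hX'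
    (V := X') (U := ⊤) le_top
  rw [IsAffineOpen.fromSpec_top, Scheme.isoSpec_Spec_inv, ← Spec.map_comp] at h1
  rw [← h1]
  rfl

/-! ### The `k`-algebra structures (file-local instances) -/

/-- The `k`-algebra structure of the chart ring `(k[a]_{(a_l)})₀` (scalars `Segre.cst`). [folklore] -/
@[reducible]
def chartBaseRingAlgebra (l : Fin (N + 1)) : Algebra k (chartBaseRing (k := k) N l) :=
  (Segre.cst k (MvPolynomial.X l)).toAlgebra

/-- The `k`-algebra structure of the sections `Γ(X, U)` of a `k`-scheme (scalars
`SchemeOver.scalarRingHom`). [folklore] -/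
@[reducible]
def sectionsAlgebra (X : SchemeOver k) (U : X.left.Opens) : Algebra k Γ(X.left, U) :=
  (SchemeOver.scalarRingHom X U).toAlgebra

attribute [local instance] chartBaseRingAlgebra sectionsAlgebra

/-- Unfolding: `algebraMap k (k[a]_{(a_l)})₀ = Segre.cst`. [folklore] -/
theorem algebraMap_chartBaseRing (l : Fin (N + 1)) :
    algebraMap k (chartBaseRing (k := k) N l) = Segre.cst k (MvPolynomial.X l) := rfl

/-- Unfolding: `algebraMap k Γ(X, U) = SchemeOver.scalarRingHom X U`. [folklore] -/
theorem algebraMap_sections (X : SchemeOver k) (U : X.left.Opens) :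
    algebraMap k Γ(X.left, U) = SchemeOver.scalarRingHom X U := rfl

/-! ### The affine chart `X' ×ₖ D₊(a_l)` of `X ×ₖ (ℙᴺ)^*` -/

section Chart

variable (l : Fin (N + 1)) (X' : X.left.affineOpens)

/-- The coordinate ring `Γ(X, X') ⊗ₖ (k[a]_{(a_l)})₀` of the affine chart `X' ×ₖ D₊(a_l)` of
`X ×ₖ (ℙᴺ)^*` (`X'` an affine open of `X`). [folklore] -/
abbrev chartRing : Type u := Γ(X.left, (X' : X.left.Opens)) ⊗[k] chartBaseRing (k := k) N l

/-- `D₊(a_l) ↪ (ℙᴺ)^*` is an open immersion (Mathlib). [folklore] -/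
instance isOpenImmersion_chartBaseι : IsOpenImmersion (chartBaseι (k := k) N l) :=
  (inferInstance :
    IsOpenImmersion (Proj.awayι 𝒜 (MvPolynomial.X l) (Segre.X_mem k l) zero_lt_one))

variable (X) in
/-- **The affine chart** `Spec (Γ(X, X') ⊗ₖ (k[a]_{(a_l)})₀) = X' ×ₖ D₊(a_l) ↪ X ×ₖ (ℙᴺ)^*`:
Mathlib's `pullbackSpecIso` followed by the fibre product of the open immersions `X' ↪ X`
(`IsAffineOpen.fromSpec`) and `D₊(a_l) ↪ (ℙᴺ)^*` (`Proj.awayι`). [folklore] -/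
def chartImm : Spec (.of (chartRing (X := X) l X')) ⟶ pullback X.hom (dualProjectiveSpace N k).hom :=
  (pullbackSpecIso k Γ(X.left, (X' : X.left.Opens)) (chartBaseRing (k := k) N l)).inv ≫
    pullback.map (Spec.map (CommRingCat.ofHom (algebraMap k Γ(X.left, (X' : X.left.Opens)))))
      (Spec.map (CommRingCat.ofHom (algebraMap k (chartBaseRing (k := k) N l))))
      X.hom (dualProjectiveSpace N k).hom X'.2.fromSpec (chartBaseι N l) (𝟙 _)
      (by rw [Category.comp_id, fromSpec_comp_hom])
      (by rw [Category.comp_id, chartBaseι_hom])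

/-- The chart followed by the first projection is `Spec (Γ(X, X') ⊗ R) → Spec Γ(X, X') = X' ⊆ X`.
[folklore] -/
@[reassoc]
theorem chartImm_fst :
    chartImm X l X' ≫ pullback.fst X.hom (dualProjectiveSpace N k).hom =
      Spec.map (CommRingCat.ofHom (algebraMap Γ(X.left, (X' : X.left.Opens)) (chartRing l X'))) ≫
        X'.2.fromSpec := by
  rw [← pullbackSpecIso_inv_fst' k Γ(X.left, (X' : X.left.Opens)) (chartBaseRing (k := k) N l),
    Category.assoc, chartImm, Category.assoc]
  congr 1
  exact pullback.lift_fst _ _ _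

/-- The chart mapped to the second standard chart `D₊(a_l)`: `Spec (Γ(X, X') ⊗ R) → Spec R`.
[folklore] -/
def chartβ : Spec (.of (chartRing (X := X) l X')) ⟶ Spec (.of (chartBaseRing (k := k) N l)) :=
  Spec.map (CommRingCat.ofHom (R := chartBaseRing (k := k) N l) (S := chartRing l X')
    (RingHomClass.toRingHom (Algebra.TensorProduct.includeRight (R := k)
      (A := Γ(X.left, (X' : X.left.Opens))) (B := chartBaseRing (k := k) N l))))

/-- The chart followed by the second projection is `Spec (Γ(X, X') ⊗ R) → Spec R = D₊(a_l) ⊆ (ℙᴺ)^*`.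
[folklore] -/
@[reassoc]
theorem chartImm_snd :
    chartImm X l X' ≫ pullback.snd X.hom (dualProjectiveSpace N k).hom = chartβ l X' ≫ chartBaseι N l := by
  rw [chartβ, ← pullbackSpecIso_inv_snd k Γ(X.left, (X' : X.left.Opens)) (chartBaseRing (k := k) N l),
    Category.assoc, chartImm, Category.assoc]
  congr 1
  exact pullback.lift_snd _ _ _

/-- The chart is an open immersion. [folklore] -/
instance isOpenImmersion_chartImm : IsOpenImmersion (chartImm X l X') := by
  unfold chartImm
  exact @IsOpenImmersion.comp _ _ _ _ _ inferInstance (Scheme.pullback_map_isOpenImmersion _ _ _ _ _ _ _ _ _)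

/-- The image of the chart is `pr₁⁻¹ X' ∩ pr₂⁻¹ D₊(a_l)`. [folklore] -/
theorem range_chartImm :
    Set.range (chartImm X l X') =
      pullback.fst X.hom (dualProjectiveSpace N k).hom ⁻¹' ((X' : X.left.Opens) : Set X.left) ∩
        pullback.snd X.hom (dualProjectiveSpace N k).hom ⁻¹'
          ((Proj.basicOpen 𝒜 (MvPolynomial.X l) : (Proj 𝒜).Opens) : Set (Proj 𝒜)) := by
  have hsurj : Function.Surjective
      (pullbackSpecIso k Γ(X.left, (X' : X.left.Opens)) (chartBaseRing (k := k) N l)).inv :=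
    (Scheme.homeoOfIso (pullbackSpecIso k Γ(X.left, (X' : X.left.Opens))
      (chartBaseRing (k := k) N l)).symm).surjective
  have hr : Set.range (chartBaseι (k := k) N l) =
      ((Proj.basicOpen 𝒜 (MvPolynomial.X l) : (Proj 𝒜).Opens) : Set (Proj 𝒜)) := by
    rw [← Scheme.Hom.coe_opensRange]
    exact congrArg SetLike.coe (Proj.opensRange_awayι 𝒜 (MvPolynomial.X l) (Segre.X_mem k l) zero_lt_one)
  rw [chartImm, Scheme.Hom.comp_base, TopCat.coe_comp, Set.range_comp, hsurj.range_eq,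
    Set.image_univ]
  erw [Scheme.Pullback.range_map]
  rw [IsAffineOpen.range_fromSpec, hr]

end Chart

/-! ### The incidence locus on the chart: `Σᵢ uᵢ ⊗ vᵢ = 0` -/

section Incidence

variable (j l : Fin (N + 1)) (X' : X.left.affineOpens)

/-- The chart mapped to the first standard chart `D₊(x_j)`:
`Spec (Γ(X, X') ⊗ R) → Spec Γ(X, X') → Spec Γ(ℙᴺ, D₊(x_j)) → Spec (k[x]_{(x_j)})₀` (the composite of
`Spec` of the scalars, of `ι^* : Γ(ℙᴺ, D₊(x_j)) → Γ(X, X')` and of Mathlib's `Proj.awayToSection`).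
[folklore] -/
def chartα (hX' : (X' : X.left.Opens) ≤ ι.left ⁻¹ᵁ Proj.basicOpen 𝒜 (MvPolynomial.X j)) :
    Spec (.of (chartRing (X := X) l X')) ⟶ Spec (.of (Away 𝒜 (MvPolynomial.X j))) :=
  Spec.map (CommRingCat.ofHom (algebraMap Γ(X.left, (X' : X.left.Opens)) (chartRing l X'))) ≫
    Spec.map (ι.left.appLE (Proj.basicOpen 𝒜 (MvPolynomial.X j)) X' hX') ≫
      Spec.map (Proj.awayToSection 𝒜 (MvPolynomial.X j))

/-- The function `x_i/x_j` pulled back along `chartα` is `uᵢ ⊗ 1` (as a global function on the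
chart). [folklore] -/
theorem pull_chartα_frac (hX' : (X' : X.left.Opens) ≤ ι.left ⁻¹ᵁ Proj.basicOpen 𝒜 (MvPolynomial.X j))
    (i : Fin (N + 1)) :
    Segre.pull (chartα ι j l X' hX') (Segre.frac k j i) =
      (Scheme.ΓSpecIso (.of (chartRing l X'))).inv (secCoord ι j X' hX' i ⊗ₜ[k] (1 : chartBaseRing N l)) := by
  rw [chartα, ← Category.assoc, Segre.pull_SpecMap, Segre.pull_SpecMap, ← Category.id_comp (Spec.map _),
    Segre.pull_SpecMap, Segre.pull_apply, Scheme.Hom.id_appTop]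
  rfl

/-- The function `a_i/a_l` pulled back along `chartβ` is `1 ⊗ vᵢ`. [folklore] -/
theorem pull_chartβ_frac (i : Fin (N + 1)) :
    Segre.pull (chartβ (X := X) l X') (Segre.frac k l i) =
      (Scheme.ΓSpecIso (.of (chartRing l X'))).inv
        ((1 : Γ(X.left, (X' : X.left.Opens))) ⊗ₜ[k] Segre.frac k l i) := by
  rw [chartβ, ← Category.id_comp (Spec.map _), Segre.pull_SpecMap, Segre.pull_apply, Scheme.Hom.id_appTop]
  rfl

/-- `Spec (Γ(X, X') ⊗ R) → Spec Γ(X, X') = X' ⊆ X → ℙᴺ` factors through the chart `D₊(x_j)`: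
it is `chartα ≫ (D₊(x_j) ↪ ℙᴺ)` (Mathlib `IsAffineOpen.SpecMap_appLE_fromSpec` and
`ProjSubscheme.fromSpec_affineBasicOpen`). [folklore] -/
theorem specMap_fromSpec_ι (hX' : (X' : X.left.Opens) ≤ ι.left ⁻¹ᵁ Proj.basicOpen 𝒜 (MvPolynomial.X j)) :
    Spec.map (CommRingCat.ofHom (algebraMap Γ(X.left, (X' : X.left.Opens)) (chartRing l X'))) ≫
        X'.2.fromSpec ≫ ι.left = chartα ι j l X' hX' ≫ Segre.chartι k j := by
  have h1 := IsAffineOpen.SpecMap_appLE_fromSpec ι.left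
    (ProjSubscheme.affineBasicOpen 𝒜 (MvPolynomial.X j) (Segre.X_mem k j) zero_lt_one).2 X'.2 hX'
  have h2 := ProjSubscheme.fromSpec_affineBasicOpen 𝒜 (MvPolynomial.X j) (Segre.X_mem k j) zero_lt_one
  have h4 : chartα ι j l X' hX' ≫ Segre.chartι k j =
      Spec.map (CommRingCat.ofHom (algebraMap Γ(X.left, (X' : X.left.Opens)) (chartRing l X'))) ≫
        Spec.map (ι.left.appLE (Proj.basicOpen 𝒜 (MvPolynomial.X j)) X' hX') ≫
          (ProjSubscheme.affineBasicOpen 𝒜 (MvPolynomial.X j) (Segre.X_mem k j) zero_lt_one).2.fromSpec := by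
    rw [h2, chartα, Category.assoc, Category.assoc]
    rfl
  have h5 := congrArg (Spec.map (CommRingCat.ofHom
    (algebraMap Γ(X.left, (X' : X.left.Opens)) (chartRing l X'))) ≫ ·) h1
  exact (h4.trans h5).symm

/-- The two chart maps are compatible over `Spec k`. [folklore] -/
theorem chartα_chartι_toSpec (hX' : (X' : X.left.Opens) ≤ ι.left ⁻¹ᵁ Proj.basicOpen 𝒜 (MvPolynomial.X j)) :
    chartα ι j l X' hX' ≫ Segre.chartι k j ≫ Segre.toSpec (Fin (N + 1)) k =
      chartβ l X' ≫ Segre.chartι k l ≫ Segre.toSpec (Fin (N + 1)) k := by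
  have e1 := specMap_fromSpec_ι ι j l X' hX'
  calc chartα ι j l X' hX' ≫ Segre.chartι k j ≫ Segre.toSpec (Fin (N + 1)) k
      = (chartα ι j l X' hX' ≫ Segre.chartι k j) ≫ Segre.toSpec (Fin (N + 1)) k :=
        (Category.assoc _ _ _).symm
    _ = (Spec.map (CommRingCat.ofHom (algebraMap Γ(X.left, (X' : X.left.Opens)) (chartRing l X'))) ≫
          X'.2.fromSpec ≫ ι.left) ≫ (projectiveSpace N k).hom := by rw [← e1]; rfl
    _ = Spec.map (CommRingCat.ofHom (algebraMap Γ(X.left, (X' : X.left.Opens)) (chartRing l X'))) ≫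
          X'.2.fromSpec ≫ X.hom := by simp only [Category.assoc, Over.w ι]
    _ = (chartImm X l X' ≫ pullback.fst X.hom (dualProjectiveSpace N k).hom) ≫ X.hom := by
          rw [chartImm_fst, Category.assoc]
    _ = chartImm X l X' ≫ pullback.snd X.hom (dualProjectiveSpace N k).hom ≫
          (dualProjectiveSpace N k).hom := by rw [Category.assoc, pullback.condition]
    _ = (chartβ l X' ≫ chartBaseι N l) ≫ (dualProjectiveSpace N k).hom := by
          rw [← chartImm_snd, Category.assoc]
    _ = chartβ l X' ≫ Segre.chartι k l ≫ Segre.toSpec (Fin (N + 1)) k := by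
          rw [Category.assoc]; rfl

/-- The chart followed by `toSegre : X ×ₖ (ℙᴺ)^* ⟶ ℙᴺ ×ₖ (ℙᴺ)^* ⟶ ℙ^{N²+2N}` is the chart-level Segre
map of the pair (`chartα`, `chartβ`) (`Segre.segreMap`: `z_{cd}/z_{jl} ↦ (x_c/x_j)(a_d/a_l)`).
[cite: Hartshorne1977, II Ex. 5.11] -/
theorem chartImm_toSegre (hX' : (X' : X.left.Opens) ≤ ι.left ⁻¹ᵁ Proj.basicOpen 𝒜 (MvPolynomial.X j)) :
    chartImm X l X' ≫ (toSegre N ι).left =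
      Segre.segreMap (segreIndexEquiv N N) j l (chartα ι j l X' hX') (chartβ l X') := by
  have hαβ := chartα_chartι_toSpec ι j l X' hX'
  -- `chartImm ≫ (ι ▷ (ℙᴺ)^*)` factors through the chart `D₊(x_j) ×ₖ D₊(a_l)` of the product cover
  have hν : (chartImm X l X' ≫ (ι ▷ dualProjectiveSpace N k).left :
      Spec (.of (chartRing l X')) ⟶ pullback (Segre.toSpec (Fin (N + 1)) k) (Segre.toSpec (Fin (N + 1)) k)) =
      pullback.lift (f := Segre.toSpec (Fin (N + 1)) k) (g := Segre.toSpec (Fin (N + 1)) k)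
        (chartα ι j l X' hX' ≫ Segre.chartι k j) (chartβ l X' ≫ Segre.chartι k l) hαβ := by
    apply pullback.hom_ext
    · have e1 : ((ι ▷ dualProjectiveSpace N k).left ≫
          pullback.fst (projectiveSpace N k).hom (dualProjectiveSpace N k).hom :
            pullback X.hom (dualProjectiveSpace N k).hom ⟶ Proj 𝒜) =
          pullback.fst X.hom (dualProjectiveSpace N k).hom ≫ ι.left := Over.whiskerRight_left_fst _
      have e2 : (chartImm X l X' ≫ pullback.fst X.hom (dualProjectiveSpace N k).hom ≫ ι.left :
          Spec (.of (chartRing l X')) ⟶ Proj 𝒜) = chartα ι j l X' hX' ≫ Segre.chartι k j := by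
        rw [← specMap_fromSpec_ι ι j l X' hX', ← chartImm_fst_assoc]
        rfl
      calc ((chartImm X l X' ≫ (ι ▷ dualProjectiveSpace N k).left) ≫
            pullback.fst (Segre.toSpec (Fin (N + 1)) k) (Segre.toSpec (Fin (N + 1)) k) :
              Spec (.of (chartRing l X')) ⟶ Proj 𝒜)
          = (chartImm X l X' ≫ (ι ▷ dualProjectiveSpace N k).left ≫
              pullback.fst (projectiveSpace N k).hom (dualProjectiveSpace N k).hom :
                Spec (.of (chartRing l X')) ⟶ Proj 𝒜) := Category.assoc _ _ _
        _ = (chartImm X l X' ≫ pullback.fst X.hom (dualProjectiveSpace N k).hom ≫ ι.left :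
                Spec (.of (chartRing l X')) ⟶ Proj 𝒜) :=
              congrArg (chartImm X l X' ≫ ·) e1
        _ = chartα ι j l X' hX' ≫ Segre.chartι k j := e2
        _ = _ := (pullback.lift_fst _ _ _).symm
    · have e1 : ((ι ▷ dualProjectiveSpace N k).left ≫
          pullback.snd (projectiveSpace N k).hom (dualProjectiveSpace N k).hom :
            pullback X.hom (dualProjectiveSpace N k).hom ⟶ (dualProjectiveSpace N k).left) =
          pullback.snd X.hom (dualProjectiveSpace N k).hom := Over.whiskerRight_left_snd _
      calc ((chartImm X l X' ≫ (ι ▷ dualProjectiveSpace N k).left) ≫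
            pullback.snd (Segre.toSpec (Fin (N + 1)) k) (Segre.toSpec (Fin (N + 1)) k) :
              Spec (.of (chartRing l X')) ⟶ (dualProjectiveSpace N k).left)
          = (chartImm X l X' ≫ (ι ▷ dualProjectiveSpace N k).left ≫
              pullback.snd (projectiveSpace N k).hom (dualProjectiveSpace N k).hom :
                Spec (.of (chartRing l X')) ⟶ (dualProjectiveSpace N k).left) := Category.assoc _ _ _
        _ = (chartImm X l X' ≫ pullback.snd X.hom (dualProjectiveSpace N k).hom :
                Spec (.of (chartRing l X')) ⟶ (dualProjectiveSpace N k).left) :=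
              congrArg (chartImm X l X' ≫ ·) e1
        _ = chartβ l X' ≫ chartBaseι N l := chartImm_snd l X'
        _ = _ := (pullback.lift_snd _ _ _).symm
  have hfac : pullback.lift (chartα ι j l X' hX') (chartβ l X') hαβ ≫
        (Segre.prodCover (Fin (N + 1)) (Fin (N + 1)) k).f (j, l) =
      pullback.lift (f := Segre.toSpec (Fin (N + 1)) k) (g := Segre.toSpec (Fin (N + 1)) k)
        (chartα ι j l X' hX' ≫ Segre.chartι k j) (chartβ l X' ≫ Segre.chartι k l) hαβ := by
    apply pullback.hom_ext
    · rw [Category.assoc, Segre.prodCover_f_fst, Segre.chartFst, pullback.lift_fst_assoc,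
        pullback.lift_fst]
    · rw [Category.assoc, Segre.prodCover_f_snd, Segre.chartSnd, pullback.lift_snd_assoc,
        pullback.lift_snd]
  have hfin : (pullback.lift (chartα ι j l X' hX') (chartβ l X') hαβ ≫
      (Segre.prodCover (Fin (N + 1)) (Fin (N + 1)) k).f (j, l)) ≫ Segre.segre k (segreIndexEquiv N N) =
      Segre.segreMap (segreIndexEquiv N N) j l (chartα ι j l X' hX') (chartβ l X') := by
    rw [Category.assoc, Segre.prodCover_f_segre, Segre.segreChart, Segre.comp_segreMap, Segre.chartFst,
      Segre.chartSnd, pullback.lift_fst, pullback.lift_snd]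
  rw [← hfin, hfac, ← hν, Category.assoc]
  rfl

/-- **The incidence equation on the chart**: `g = Σᵢ uᵢ ⊗ vᵢ ∈ Γ(X, X') ⊗ₖ (k[a]_{(a_l)})₀`,
`uᵢ = ι^*(xᵢ/x_j)|_{X'}`, `vᵢ = aᵢ/a_l` — the bihomogeneous incidence form `Σᵢ aᵢ xᵢ` divided by
`x_j a_l`. [cite: VoisinHodgeII2003, §3.2.2] -/
def incidenceFun (hX' : (X' : X.left.Opens) ≤ ι.left ⁻¹ᵁ Proj.basicOpen 𝒜 (MvPolynomial.X j)) :
    chartRing (X := X) l X' :=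
  ∑ i : Fin (N + 1), secCoord ι j X' hX' i ⊗ₜ[k] Segre.frac k l i

/-- The Segre chart ring map sends `(Σᵢ z_{ii})/z_{jl}` to `Σᵢ (uᵢ ⊗ 1)(1 ⊗ vᵢ)`, i.e. to the global
function on `Spec (Γ(X, X') ⊗ R)` corresponding to `incidenceFun`. [folklore] -/
theorem segreRingHom_incidence (hX' : (X' : X.left.Opens) ≤ ι.left ⁻¹ᵁ Proj.basicOpen 𝒜 (MvPolynomial.X j)) :
    Segre.segreRingHom (segreIndexEquiv N N) j l (chartα ι j l X' hX') (chartβ l X')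
        (Away.isLocalizationElem (Segre.X_mem k (segreIndexEquiv N N (j, l)))
          (isHomogeneous_incidenceForm N (k := k))) =
      (Scheme.ΓSpecIso (.of (chartRing l X'))).inv (incidenceFun ι j l X' hX') := by
  rw [Away.isLocalizationElem, Segre.segreRingHom_awayMk, pow_one, incidenceForm, map_sum, incidenceFun,
    map_sum]
  refine Finset.sum_congr rfl fun i _ ↦ ?_
  rw [Segre.segreFun_X_apply, pull_chartα_frac, pull_chartβ_frac, ← map_mul,
    Algebra.TensorProduct.tmul_mul_tmul, mul_one, one_mul]

/-- **The incidence locus in the coordinates of the chart**: the preimage of the incidence locus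
`𝒳 = {Σᵢ aᵢ xᵢ = 0} ⊆ X ×ₖ (ℙᴺ)^*` under the chart `Spec (Γ(X, X') ⊗ₖ R) = X' ×ₖ D₊(a_l) ↪ X ×ₖ (ℙᴺ)^*`
is the zero locus of `g = Σᵢ uᵢ ⊗ vᵢ`. [cite: VoisinHodgeII2003, §3.2.2] -/
theorem preimage_chartImm_incidenceLocus
    (hX' : (X' : X.left.Opens) ≤ ι.left ⁻¹ᵁ Proj.basicOpen 𝒜 (MvPolynomial.X j)) :
    chartImm X l X' ⁻¹' (incidenceLocus N ι : Set (X ⊗ dualProjectiveSpace N k).left) =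
      PrimeSpectrum.zeroLocus {incidenceFun ι j l X' hX'} := by
  ext x
  have hfun : (toSegre N ι).left (chartImm X l X' x) =
      Segre.segreMap (segreIndexEquiv N N) j l (chartα ι j l X' hX') (chartβ l X') x :=
    congrArg (fun φ : Spec (.of (chartRing l X')) ⟶ (projectiveSpace (N * N + N + N) k).left ↦ φ x)
      (chartImm_toSegre ι j l X' hX')
  -- the global function of the incidence form on the chart, and the point `toSpecΓ x`
  set ρ := Segre.segreRingHom (segreIndexEquiv N N) j l (chartα ι j l X' hX') (chartβ l X') with hρ
  set z := (Spec (CommRingCat.of (chartRing l X'))).toSpecΓ x with hz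
  set q := Away.isLocalizationElem (Segre.X_mem k (segreIndexEquiv N N (j, l)))
    (isHomogeneous_incidenceForm N (k := k)) with hq
  have hρq : ρ q = (Scheme.ΓSpecIso (.of (chartRing l X'))).inv (incidenceFun ι j l X' hX') :=
    segreRingHom_incidence ι j l X' hX'
  have step1 : x ∈ chartImm X l X' ⁻¹' (incidenceLocus N ι : Set (X ⊗ dualProjectiveSpace N k).left) ↔
      Spec.map (CommRingCat.ofHom ρ) z ∈
        Proj.awayι (Segre.grading (Fin (N * N + N + N + 1)) k)
            (MvPolynomial.X (segreIndexEquiv N N (j, l))) (Segre.X_mem k (segreIndexEquiv N N (j, l)))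
            zero_lt_one ⁻¹'
          ProjectiveSpectrum.zeroLocus (Segre.grading (Fin (N * N + N + N + 1)) k) {incidenceForm N} := by
    change (toSegre N ι).left (chartImm X l X' x) ∈
      ProjectiveSpectrum.zeroLocus (Segre.grading (Fin (N * N + N + N + 1)) k) {incidenceForm N} ↔ _
    rw [hfun]
    rfl
  have step2 := Set.ext_iff.mp (ProjSubscheme.awayι_preimage_zeroLocus
    (Segre.grading (Fin (N * N + N + N + 1)) k) (Segre.X_mem k (segreIndexEquiv N N (j, l))) zero_lt_one
    (isHomogeneous_incidenceForm N (k := k)) zero_lt_one) (Spec.map (CommRingCat.ofHom ρ) z)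
  have step3 : Spec.map (CommRingCat.ofHom ρ) z ∈ PrimeSpectrum.zeroLocus {q} ↔
      z ∈ PrimeSpectrum.zeroLocus {ρ q} := by
    refine (PrimeSpectrum.mem_zeroLocus _ _).trans (Set.singleton_subset_iff.trans ?_)
    refine Iff.trans ?_ ((PrimeSpectrum.mem_zeroLocus _ _).trans Set.singleton_subset_iff).symm
    exact Iff.rfl
  have step4 : z ∈ PrimeSpectrum.zeroLocus {ρ q} ↔ x ∈ PrimeSpectrum.zeroLocus {incidenceFun ι j l X' hX'} := by
    have h := Set.ext_iff.mp ((Spec (CommRingCat.of (chartRing l X'))).toSpecΓ_preimage_zeroLocus {ρ q}) x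
    refine h.trans ((Scheme.mem_zeroLocus_iff _ _ _).trans ?_)
    refine Iff.trans ?_ ((PrimeSpectrum.mem_zeroLocus _ _).trans Set.singleton_subset_iff).symm
    simp only [Set.mem_singleton_iff, forall_eq]
    rw [hρq, basicOpen_eq_of_affine]
    exact not_not
  exact step1.trans (step2.trans (step3.trans step4))

end Incidence

/-! ### The piece of the universal hyperplane section over the chart -/

section ChartSection

variable (j l : Fin (N + 1)) (X' : X.left.affineOpens)

variable (N) in
/-- The universal hyperplane section is reduced (it carries the reduced induced structure: over an
affine open its ring is the quotient by a vanishing ideal, which is radical).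
[cite: Hartshorne1977, II Example 3.2.6] -/
theorem isReduced_universalHyperplaneSection_left : IsReduced (universalHyperplaneSection N ι).left := by
  change IsReduced (incidenceIdeal N ι).subscheme
  haveI : ∀ U, IsReduced ((incidenceIdeal N ι).subschemeCover.openCover.X U) := by
    intro (U : (X ⊗ dualProjectiveSpace N k).left.affineOpens)
    change IsReduced (Spec (.of (Γ((X ⊗ dualProjectiveSpace N k).left, (U : (X ⊗ dualProjectiveSpace N k).left.Opens)) ⧸
      (incidenceIdeal N ι).ideal U)))
    haveI : _root_.IsReduced (Γ((X ⊗ dualProjectiveSpace N k).left, (U : (X ⊗ dualProjectiveSpace N k).left.Opens)) ⧸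
        (incidenceIdeal N ι).ideal U) := by
      rw [← Ideal.isRadical_iff_quotient_reduced, incidenceIdeal, Scheme.IdealSheafData.vanishingIdeal_ideal]
      exact PrimeSpectrum.isRadical_vanishingIdeal _
    infer_instance
  exact IsReduced.of_openCover _ (incidenceIdeal N ι).subschemeCover.openCover

variable (X) in
/-- **The piece `𝒳 ∩ (X' ×ₖ D₊(a_l))` of the universal hyperplane section over the affine chart**, as a
scheme: the fibre product of `𝒳 ↪ X ×ₖ (ℙᴺ)^*` with the chart. [cite: VoisinHodgeII2003, §3.2.2] -/
def chartSection : Scheme.{u} :=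
  pullback (emb N ι).left (chartImm X l X')

/-- The closed immersion `𝒳 ∩ (X' ×ₖ D₊(a_l)) ↪ X' ×ₖ D₊(a_l) = Spec (Γ(X, X') ⊗ₖ R)`. [folklore] -/
def chartSectionι : chartSection X ι l X' ⟶ Spec (.of (chartRing (X := X) l X')) :=
  pullback.snd (emb N ι).left (chartImm X l X')

/-- The open immersion `𝒳 ∩ (X' ×ₖ D₊(a_l)) ↪ 𝒳`. [folklore] -/
def chartSectionToSection : chartSection X ι l X' ⟶ (universalHyperplaneSection N ι).left :=
  pullback.fst (emb N ι).left (chartImm X l X')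

/-- `chartSectionι` is a closed immersion (base change of `𝒳 ↪ X ×ₖ (ℙᴺ)^*`). [folklore] -/
instance isClosedImmersion_chartSectionι : IsClosedImmersion (chartSectionι ι l X') :=
  MorphismProperty.pullback_snd (P := @IsClosedImmersion) _ _ inferInstance

/-- `chartSectionToSection` is an open immersion (base change of the chart). [folklore] -/
instance isOpenImmersion_chartSectionToSection : IsOpenImmersion (chartSectionToSection ι l X') :=
  MorphismProperty.pullback_fst (P := @IsOpenImmersion) _ _ (isOpenImmersion_chartImm l X')

/-- The piece is reduced (an open subscheme of the reduced `𝒳`). [folklore] -/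
instance isReduced_chartSection : IsReduced (chartSection X ι l X') :=
  haveI := isReduced_universalHyperplaneSection_left N ι
  isReduced_of_isOpenImmersion (chartSectionToSection ι l X')

/-- The square `𝒳 ∩ (X' × D₊(a_l)) → 𝒳 → X × (ℙᴺ)^*` = `… → Spec (Γ(X, X') ⊗ R) → X × (ℙᴺ)^*` commutes.
[folklore] -/
@[reassoc]
theorem chartSectionToSection_emb :
    chartSectionToSection ι l X' ≫ (emb N ι).left = chartSectionι ι l X' ≫ chartImm X l X' :=
  pullback.condition

/-- The image of `𝒳 ∩ (X' ×ₖ D₊(a_l))` in the chart is the zero locus of `g = Σᵢ uᵢ ⊗ vᵢ`.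
[cite: VoisinHodgeII2003, §3.2.2] -/
theorem range_chartSectionι (hX' : (X' : X.left.Opens) ≤ ι.left ⁻¹ᵁ Proj.basicOpen 𝒜 (MvPolynomial.X j)) :
    Set.range (chartSectionι ι l X') = PrimeSpectrum.zeroLocus {incidenceFun ι j l X' hX'} := by
  refine (Scheme.Pullback.range_snd (emb N ι).left (chartImm X l X')).trans ?_
  rw [range_emb]
  exact preimage_chartImm_incidenceLocus ι j l X' hX'

/-- **Local structure of the universal hyperplane section**: any REDUCED closed subscheme
`C ↪ Spec (Γ(X, X') ⊗ₖ R)` with support the zero locus of `g = Σᵢ uᵢ ⊗ vᵢ` is isomorphic, over the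
chart, to the piece `𝒳 ∩ (X' ×ₖ D₊(a_l))` of the universal hyperplane section (uniqueness of the
reduced closed subscheme structure, Hartshorne II Example 3.2.6; for instance
`C = Spec Γ(X, X')[vᵢ : i ≠ j, l]` when `j ≠ l`, the graph of `v_j = -(u_l + Σ'' uᵢ vᵢ)`).
[cite: Hartshorne1977, II Example 3.2.6] [cite: VoisinHodgeII2003, §3.2.2] -/
theorem exists_iso_chartSection {C : Scheme.{u}} (γ : C ⟶ Spec (.of (chartRing (X := X) l X')))
    [IsClosedImmersion γ] [IsReduced C]
    (hX' : (X' : X.left.Opens) ≤ ι.left ⁻¹ᵁ Proj.basicOpen 𝒜 (MvPolynomial.X j))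
    (hγ : Set.range γ = PrimeSpectrum.zeroLocus {incidenceFun ι j l X' hX'}) :
    ∃ e : C ≅ chartSection X ι l X', e.hom ≫ chartSectionι ι l X' = γ :=
  exists_iso_of_isClosedImmersion_of_range_eq (chartSectionι ι l X') γ
    ((range_chartSectionι ι j l X' hX').trans hγ.symm)

end ChartSection



end UniversalHyperplaneSection

end Literature.AlgebraicGeometry.Motives

end
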